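/-
COR-CM (cell pub-hodgecm2) — Δ2 BRIDGE, COORDINATOR «T-SIGN TEST» (21:28Z 2026-08-23), seat d2bridge-prove-6 (Ω-pin owner): AT THE Ω-PIN
INSTANTIATION, IS `Φ_{μ_i} = lineType (line i)` (MIRROR) OR ITS CONJUGATE (CONJ)?  KERNEL ANSWER: **MIRROR, FORCED** — by [Liu2021,
Def. 4.12] itself at the ε-normaliser of record `δ′ = (2δ_L)⁻¹`: the line's own collection `ε_a` is `μ`-admissible (the Def. 4.12 witness
`e₀ = a·(2δ_L)⁻¹` inside F4's `admIndexAtDeltaPrime`, i.e. the Ω-pin's `σ` EXISTS at the line `⟨a⟩`) IF AND ONLY IF `Φ_μ` is δ-positive at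
`a`, i.e. `Φ_μ = Φ^δ(a) = SignRecipe.lineType a` (the port's line type, `η_L = δ_L`).  Under CONJ (`Im τ(δ_L a) < 0` on `Φ_μ`) the element
`a·(2δ_L)⁻¹` is NOT `μ`-admissible, so no admissible index `(ε_a, χ)` and no Ω-pin value exists at that line for that `μ`.
Theorems only; imports two landed tree modules; nothing cited beyond Def. 4.12; HC_CM is NOT proved; no pointer moves.
-/
import Summits.HodgeConjecture.CorCM.D2Bridge.OmegaAtDeltaPrime
import Summits.HodgeConjecture.CorCM.D2Bridge.HcmS1PinAdmLine
import HarnessLib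

set_option autoImplicit false

/-!
# T-SIGN at the Ω-pin: Def. 4.12 admissibility at `δ′ = (2δ_L)⁻¹` ⟺ δ-positivity ⟺ `Φ_μ = lineType a` (MIRROR)

* `deltaPos_of_isAdmissibleElement_mul` — for ANY normaliser `δ′` anti-oriented to `δ_F` and real `a`: `a·δ′` admissible for `Φ`
  ⟹ `∀ τ ∈ Φ, 0 < Im τ(δ_F·a)` (converse of F2's `OmegaTransport.isAdmissibleElement_mul_of_antiOriented`);
* `cmType_eq_lineType_of_isAdmissibleElement` — at `δ′ := (2 * imagUnit L)⁻¹`: `a·(2δ_L)⁻¹` admissible for `Φ_μ` ⟹ `Φ_μ = lineType a` (MIRROR);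
* `not_isAdmissibleElement_of_deltaNeg` — CONJ orientation ⟹ `a·(2δ_L)⁻¹` is NOT `μ`-admissible (no Ω-pin index at that line);
* `cmType_eq_lineType_of_omegaPinKey` — the Ω-pin's own key hypothesis `hΦ` (F4 `admIndexAtDeltaPrime`'s binder, at `a := r ε`) IS MIRROR.
-/

noncomputable section

namespace Summit.HodgeConjecture.CorCM.D2Bridge.TSign

open NumberField
open Literature.AlgebraicGeometry.Motives
open Literature.AlgebraicGeometry.Liu2021 (IsAdmissibleElement)
open Literature.NumberTheory.Automorphic Literature.NumberTheory.Automorphic.IdeleClassGroup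
open Literature.NumberTheory.Automorphic.Liu2021
open Literature.NumberTheory.Automorphic.Liu2021.Def411WeilCarriers (Rep Eps)
open Literature.NumberTheory.GelbartRogawski1991.UnitaryDualPair
open Summit.HodgeConjecture.CorCM.Transposition.OmegaTransport

/-! ## §1 Arithmetic: admissibility of `a·δ′` forces δ-positivity at `a` (any anti-oriented `δ′`) -/

/-- **Def. 4.12 admissibility of `a·δ′` (δ′ anti-oriented to `δ_F`, `a` real) FORCES `0 < Im τ(δ_F·a)` on the type** — the converse of
`OmegaTransport.isAdmissibleElement_mul_of_antiOriented`: `Im τ(aδ′) = Re τ(a)·Im τ(δ′) < 0` and `Im τ(δ′)·Im τ(δ_F) < 0` give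
`Im τ(δ_F a) = Im τ(δ_F)·Re τ(a) > 0`. [cite: Liu2021, Def. 4.12 (FJcycle.tex l. 2102–2108)] -/
theorem deltaPos_of_isAdmissibleElement_mul (F : CMField) (Φ : Set (F →+* ℂ)) (a δ' : F)
    (ha : IsCMField.complexConj F a = a) (hδ' : ∀ τ : F →+* ℂ, (τ δ').im * (τ (imagUnit F)).im < 0)
    (hadm : IsAdmissibleElement F Φ (a * δ')) :
    ∀ τ : F →+* ℂ, τ ∈ Φ → 0 < (τ (imagUnit F * a)).im := by
  intro τ hτ
  -- `τ(a)` is real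
  have hre : (τ a).im = 0 := by
    have h : τ (IsCMField.complexConj F a) = starRingEnd ℂ (τ a) := IsCMField.complexEmbedding_complexConj (K := F) τ a
    rw [ha] at h
    exact Complex.conj_eq_iff_im.1 h.symm
  have h1 : (τ (a * δ')).im < 0 := hadm.2.2 τ hτ
  have h2 := hδ' τ
  have hne : (τ δ').im ≠ 0 := fun h0 => by
    rw [h0, zero_mul] at h2
    exact lt_irrefl 0 h2
  simp only [map_mul, Complex.mul_im, hre, mul_zero, zero_mul, zero_add, add_zero] at h1 ⊢
  have h3 : 0 < (τ a).re * (τ δ').im * ((τ δ').im * (τ (imagUnit F)).im) := mul_pos_of_neg_of_neg h1 h2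
  have h4 : 0 < (τ δ').im * (τ δ').im := mul_self_pos.2 hne
  nlinarith [h3, h4]

/-! ## §2 At `δ′ = (2δ_L)⁻¹` and a conjugate-symplectic `μ` over a port field code `L`: MIRROR, and CONJ is uninhabited -/

section Mirror

variable {L : HodgeCM.CMField} [IsGalois ℚ L]
  {μ : Literature.NumberTheory.Automorphic.IdeleClassGroup L →ₜ* Circle}
  (hμ : Literature.NumberTheory.Automorphic.IdeleClassGroup.IsConjugateSymplectic L μ)

/-- **T-SIGN = MIRROR.**  If the line scalar `a` (real, non-zero) carries a `μ`-admissible element at the normaliser of record —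
`a·(2δ_L)⁻¹` admissible for `Φ_μ` ([Liu2021, Def. 4.12]; this is the witness behind the Ω-pin's index `σ`, F4 `admIndexAtDeltaPrime`) —
then `Φ_μ = lineType a` (the port's `Φ^δ(a)`), NOT its conjugate. [cite: Liu2021, Def. 4.12 (FJcycle.tex l. 2102–2108)] -/
theorem cmType_eq_lineType_of_isAdmissibleElement (a : L) (ha : IsCMField.complexConj (L : Type) a = a) (ha0 : a ≠ 0)
    (hadm : IsAdmissibleElement (L : Type) hμ.cmType.1 (a * (2 * imagUnit (L : Type))⁻¹)) :
    hμ.cmType = HodgeCM.SignRecipe.lineType a ha ha0 :=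
  cmType_eq_lineType_of_deltaPos hμ a ha ha0
    (deltaPos_of_isAdmissibleElement_mul ⟨L.K⟩ hμ.cmType.1 a (2 * imagUnit (L : Type))⁻¹ ha
      (antiOriented_inv_two_mul_imagUnit ⟨L.K⟩) hadm)

/-- **CONJ is uninhabited at the Ω-pin**: if `Φ_μ` is δ-NEGATIVE at `a` (`Im τ(δ_L a) < 0` on `Φ_μ`, i.e. `Φ_μ = (lineType a)ᶜᵒⁿʲ`), then
`a·(2δ_L)⁻¹` is NOT `μ`-admissible — [Liu2021, Def. 4.12] has no witness on the line `⟨a⟩` for such a `μ`, so no admissible index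
`(ε_a, χ)` and no Ω-pin value exists there. [cite: Liu2021, Def. 4.12 (FJcycle.tex l. 2102–2108)] -/
theorem not_isAdmissibleElement_of_deltaNeg (a : L) (ha : IsCMField.complexConj (L : Type) a = a)
    (hneg : ∀ τ : (L : Type) →+* ℂ, τ ∈ hμ.cmType.1 → (τ (imagUnit (L : Type) * a)).im < 0)
    {τ₀ : (L : Type) →+* ℂ} (hτ₀ : τ₀ ∈ hμ.cmType.1) :
    ¬ IsAdmissibleElement (L : Type) hμ.cmType.1 (a * (2 * imagUnit (L : Type))⁻¹) := fun hadm =>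
  lt_asymm (hneg τ₀ hτ₀)
    (deltaPos_of_isAdmissibleElement_mul ⟨L.K⟩ hμ.cmType.1 a (2 * imagUnit (L : Type))⁻¹ ha
      (antiOriented_inv_two_mul_imagUnit ⟨L.K⟩) hadm τ₀ hτ₀)

/-- **The Ω-pin's own key is MIRROR**: F4's `admIndexAtDeltaPrime … r μ hμ hw ε hε hΦ …` asks
`hΦ : ∀ τ ∈ Φ_μ, 0 < Im τ(δ_L·(r ε))` at the line of record `a := r ε`; that hypothesis IS `Φ_μ = lineType (r ε)`.
[cite: Liu2021, Def. 4.12 (FJcycle.tex l. 2102–2108)] -/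
theorem cmType_eq_lineType_of_omegaPinKey (r : Rep ↥(maximalRealSubfield (L : Type)) (imagUnitSq (L : Type)))
    (ε : Eps ↥(maximalRealSubfield (L : Type)) (imagUnitSq (L : Type)))
    (hΦ : ∀ τ : (L : Type) →+* ℂ, τ ∈ hμ.cmType.1 →
      0 < (τ (imagUnit (L : Type) * algebraMap ↥(maximalRealSubfield (L : Type)) (L : Type) (r.toFun ε))).im) :
    hμ.cmType = HodgeCM.SignRecipe.lineType (algebraMap ↥(maximalRealSubfield (L : Type)) (L : Type) (r.toFun ε))
      ((IsCMField.complexConj (L : Type)).commutes _) ((map_ne_zero _).2 (r.toFun ε).ne_zero) :=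
  cmType_eq_lineType_of_deltaPos hμ _ _ _ hΦ

end Mirror

end Summit.HodgeConjecture.CorCM.D2Bridge.TSign

end
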